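import Literature.Algebra.Lie.LefschetzModuleSL2Representation
import Literature.Algebra.Lie.LefschetzSubmodule
import HarnessLib

/-!
# "The primitive elements are exactly the lowest weight elements for the action of `SL₂`" (Beauville 2010, §5):
# `P_{−k} = M_{−k} ∩ ker ᶜΛ`, lowest weights are `≤ 0`, `ker ᶜΛ = ⊕_k P_{−k}`, and the lower unipotents of `SL₂(K)` fix exactly `ker ᶜΛ`

[topic Algebra/Lie]

Layer `Literature/Algebra/Lie` (namespace `Literature.Algebra.Lie`), lane `lit-hodgefound` (Track 2 foundations library; prover seat
`lit-hodgefound-p34`, generation 38, row g38-#6), the sequel of `LefschetzModuleSL2Representation.lean` (row g38-#1: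
`HasLefschetzProperty.sl2Rep`, `ρ(1 0 ; a 1) = exp(a f)`) and `LefschetzModuleSL2RepresentationStrings.lean` (row g38-#5: the strings of
primitive vectors are the irreducible subrepresentations).  THEOREMS ONLY (no `def`, no named fact, no instance, no notation, no local
instance; net debt `0`).

## Sources, VERBATIM

* A. Beauville, *The action of SL₂ on abelian varieties*, J. Ramanujan Math. Soc. 25 (2010), arXiv:0805.1541 [Beauville2010SL2], §5
  (held `paper:arxiv-0805.1541` p0006): "We say that an element `z ∈ CH^p_s(A)` is primitive if `θ^{g−1} ∗ z = 0` [i.e. `Y z = 0`,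
  `Y z = d⁻¹ (θ^{g−1}/(g−1)!) ∗ z`, §4]. The primitive elements are exactly the lowest weight elements for the action of `SL₂` on
  `CH(A)`. […] **Proposition.** If `z ∈ CH^p_s(A)` is primitive, we have `g+s−2p ≥ 0` [its weight `2p−g−s` is `≤ 0`], and
  `(z, θz, …, θ^{g+s−2p} z)` is a basis of an irreducible subrepresentation"; §4 Theorem: "`(1 0 ; a 1)·z = d⁻¹ a^g e^{θ/a} ∗ z`",
  "`H z = (2p − g − s) z`".
* B. C. Hall, *Lie Groups, Lie Algebras, and Representations*, 2nd ed. (2015) [Hall2015], Ch. 2 Exercise 9 (p. 53 of the held copy): "if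
  `X` is nilpotent, then `log(exp X) = X`" (`exp` is injective on nilpotents); Thm. 4.32 ff. (irreducible representations of `sl(2; ℂ)`:
  the weights of a lowest/highest weight vector in a finite-dimensional representation are integers of the right sign).

In the tree's language (`LefschetzModule.lean`): `P_{−k} = primitiveSpace h e k = M_{−k} ⊓ ker e^{k+1}` (Cattani's definition through
the RAISING operator), `f = ᶜΛ = L.dual hgr` the `𝔰𝔩₂`-partner.  Beauville's "primitive" is `Y z = 0`, i.e. `z ∈ ker f`; this file proves
the two notions agree on homogeneous vectors and identifies `ker f` globally.

## What is PROVED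

* §1 `dual_apply_pow_succ_of_dual_apply_eq_zero` (`f x = 0`, `x ∈ M_m` ⇒ `f(e^{j+1} x) = (j+1)(−m−j) eʲ x`, the string relations of a
  lowest weight vector), `pow_apply_eq_zero_of_dual_apply_eq_zero` (DESCENT: if the coefficients `(j+1)(−m−j)`, `j ≥ j₁`, are non-zero
  then `e^{j₁} x = 0`, descending from `eⁿ = 0`), **`pow_succ_apply_eq_zero_of_dual_apply_eq_zero`** (`x ∈ M_{−k}`, `f x = 0` ⇒
  `e^{k+1} x = 0`),
  **`mem_primitiveSpace_iff_dual_apply_eq_zero`** (`x ∈ M_{−k}`: `x ∈ P_{−k} ↔ f x = 0`), **`primitiveSpace_eq_degreeSpace_inf_ker_dual`**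
  (`P_{−k} = M_{−k} ∩ ker f`), **`eq_zero_of_dual_apply_eq_zero_of_pos`** ("`g + s − 2p ≥ 0`": a homogeneous vector of POSITIVE weight
  killed by `f` is `0` — all the coefficients are non-zero), **`ker_dual_eq_iSup_primitiveSpace`** (`ker f = ⊕_k P_{−k}`: `ker f` is
  `h`-stable hence graded, `isZGrading_restrict`).
* §2 AT GROUP LEVEL: `apply_eq_zero_of_exp_apply_eq_self` (`a` nilpotent, `exp(a) x = x` ⇒ `a x = 0`: `exp a − 1 = a·g` with
  `g = 1 + (nilpotent)` invertible), **`dual_apply_eq_zero_of_sl2Rep_apply_eq_self`** (ONE lower unipotent `ρ(1 0 ; a 1)`, `a ≠ 0`, fixing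
  `x` forces `f x = 0`), **`sl2Rep_apply_eq_self_of_dual_apply_eq_zero`** (conversely `f x = 0` ⇒ every `ρ(1 0 ; a 1)` fixes `x`),
  **`mem_primitiveSpace_iff_forall_sl2Rep_apply_eq_self`** (for `x ∈ M_{−k}`: `x ∈ P_{−k}` iff `x` is fixed by the lower unipotent
  subgroup — "the primitive elements are exactly the lowest weight elements for the action of `SL₂`").

## References

* [Beauville2010SL2] A. Beauville, *The action of SL₂ on abelian varieties*, J. Ramanujan Math. Soc. 25 (2010) 253–263, arXiv:0805.1541, §4–§5.
* [Hall2015] B. C. Hall, *Lie Groups, Lie Algebras, and Representations: An Elementary Introduction*, 2nd ed., GTM 222 (2015), Ch. 2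
  Exercise 9, §4.6 (Thm. 4.32).
* [CattaniElZeinGriffithsLe2014] E. Cattani, F. El Zein, P. A. Griffiths, Lê D. T. (eds.), *Hodge Theory* (2014), App. A (A.3.5), Prop. A.3.9
  ("`P_ℓ = ker{N₋ : V_ℓ → V_{ℓ+2}}`").
-/

noncomputable section

namespace Literature.Algebra.Lie

open Module Function Set
open scoped Nat MatrixGroups
open HasLefschetzProperty (primitiveSpace mem_primitiveSpace_iff)

variable {K : Type*} [Field K] [CharZero K] {M : Type*} [AddCommGroup M] [Module K M] {h e : Module.End K M}

/-! ### §0 `exp` is injective on nilpotents: `exp(a) x = x ⇒ a x = 0` -/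

/-- `exp a = Σ_{i<n} aⁱ/i!` with coefficients in `K`, for `aⁿ = 0`. [folklore] -/
private theorem exp_eq_sum_range''' {a : Module.End K M} {n : ℕ} (ha : a ^ n = 0) :
    letI := Algebra.compHom (Module.End K M) (algebraMap ℚ K)
    IsNilpotent.exp a = ∑ i ∈ Finset.range n, ((i ! : ℕ) : K)⁻¹ • a ^ i := by
  letI := Algebra.compHom (Module.End K M) (algebraMap ℚ K)
  rw [IsNilpotent.exp_eq_sum ha]
  refine Finset.sum_congr rfl fun i _ ↦ ?_
  rw [Algebra.compHom_smul_def, map_inv₀, map_natCast]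

/-- **`exp(a) x = x` forces `a x = 0`** for a nilpotent `a`: `exp a − 1 = a g` with `g = Σ_{i} aⁱ/(i+1)! = 1 + (nilpotent)` invertible
and commuting with `a`, so `g (a x) = (exp a − 1) x = 0`.  (Over an arbitrary field of characteristic `0`, `exp` through
`ℚ → K → End_K(M)`; the tree's `Literature.AlgebraicGeometry.Motives.apply_eq_zero_of_exp_apply_eq_self` is the `ℚ`-linear twin.)
[cite: Hall2015, Ch. 2 Exercise 9 (p. 53: "if X is nilpotent, then log(exp X) = X")] -/
theorem apply_eq_zero_of_exp_apply_eq_self {a : Module.End K M} (ha : IsNilpotent a) {x : M}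
    (hx : letI := Algebra.compHom (Module.End K M) (algebraMap ℚ K); IsNilpotent.exp a x = x) : a x = 0 := by
  letI := Algebra.compHom (Module.End K M) (algebraMap ℚ K)
  obtain ⟨m, hm⟩ := ha
  have hm1 : a ^ (m + 1) = 0 := by rw [pow_succ, hm, zero_mul]
  have hm2 : a ^ (m + 2) = 0 := by rw [pow_succ, hm1, zero_mul]
  set g : Module.End K M := ∑ i ∈ Finset.range (m + 1), (((i + 1)! : ℕ) : K)⁻¹ • a ^ i with hg
  have hexp : IsNilpotent.exp a = 1 + a * g := by
    rw [exp_eq_sum_range''' hm2, Finset.sum_range_succ', pow_zero, Nat.factorial_zero, Nat.cast_one, inv_one, one_smul, add_comm,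
      hg, Finset.mul_sum]
    congr 1
    refine Finset.sum_congr rfl fun i _ ↦ ?_
    rw [mul_smul_comm, ← pow_succ']
  have hcomm : Commute a g := by
    rw [hg]
    exact Commute.sum_right _ _ _ fun i _ ↦ ((Commute.refl a).pow_right i).smul_right _
  have hgu : IsUnit g := by
    have hN : g = 1 + a * ∑ i ∈ Finset.range m, (((i + 2)! : ℕ) : K)⁻¹ • a ^ i := by
      rw [hg, Finset.sum_range_succ', pow_zero, zero_add, Nat.factorial_one, Nat.cast_one, inv_one, one_smul, add_comm, Finset.mul_sum]
      congr 1
      refine Finset.sum_congr rfl fun i _ ↦ ?_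
      rw [mul_smul_comm, ← pow_succ']
    rw [hN]
    refine IsNilpotent.isUnit_one_add (Commute.isNilpotent_mul_right ?_ ⟨m, hm⟩)
    exact Commute.sum_right _ _ _ fun i _ ↦ ((Commute.refl a).pow_right i).smul_right _
  have h1 : (a * g) x = 0 := by
    rw [hexp, LinearMap.add_apply, Module.End.one_apply, add_eq_left] at hx
    exact hx
  have h2 : g (a x) = 0 := by rw [← Module.End.mul_apply, ← hcomm.eq, h1]
  exact ((Module.End.isUnit_iff _).mp hgu).1 (by rw [h2, map_zero])

namespace HasLefschetzProperty

variable [FiniteDimensional K M]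

/-! ### §1 `P_{−k} = M_{−k} ∩ ker f`; lowest weights are `≤ 0`; `ker f = ⊕ P_{−k}` -/

/-- **The string relations of a lowest weight vector**: for `x ∈ M_m` with `f x = 0`, `f (e^{j+1} x) = (j+1)(−m−j) · eʲ x`
(induction on `j` from `f e = e f − h`). [cite: Beauville2010SL2, §5 (p. 6)] [cite: Hall2015, §4.6 (Thm. 4.32, proof: the relations of a string)] -/
theorem dual_apply_pow_succ_of_dual_apply_eq_zero (L : HasLefschetzProperty h e) (hgr : IsZGrading h) {m : ℤ} {x : M}
    (hx : x ∈ degreeSpace h m) (hf : L.dual hgr x = 0) (j : ℕ) :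
    L.dual hgr ((e ^ (j + 1)) x) = (((j + 1) * (-m - j) : ℤ) : K) • (e ^ j) x := by
  induction j with
  | zero =>
    have h1 := LinearMap.congr_fun (L.lie_e_dual hgr) x
    rw [Ring.lie_def, LinearMap.sub_apply, Module.End.mul_apply, Module.End.mul_apply, hf, map_zero, zero_sub,
      mem_degreeSpace_iff.1 hx, neg_eq_iff_eq_neg, ← neg_smul] at h1
    rw [zero_add, pow_one, pow_zero, Module.End.one_apply, h1]
    congr 1
    push_cast
    ring
  | succ j ih =>
    have h1 := LinearMap.congr_fun (L.lie_e_dual hgr) ((e ^ (j + 1)) x)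
    rw [Ring.lie_def, LinearMap.sub_apply, Module.End.mul_apply, Module.End.mul_apply, ih, map_smul,
      mem_degreeSpace_iff.1 (L.pow_apply_mem hx (j + 1)), sub_eq_iff_eq_add] at h1
    have h2 : L.dual hgr (e ((e ^ (j + 1)) x)) = (((j + 1) * (-m - j) : ℤ) : K) • e ((e ^ j) x) -
        ((m + 2 * ((j + 1 : ℕ) : ℤ) : ℤ) : K) • (e ^ (j + 1)) x := by
      rw [eq_sub_iff_add_eq, add_comm]
      exact h1.symm
    rw [pow_succ', Module.End.mul_apply, h2, ← Module.End.mul_apply e (e ^ j), ← pow_succ', ← sub_smul]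
    congr 1
    push_cast
    ring

/-- **Descent**: if `x ∈ M_m`, `f x = 0` and the string coefficients `(j+1)(−m−j)` are non-zero for all `j ≥ j₁`, then `e^{j₁} x = 0`
(from `eⁿ = 0` down: `e^{j+1} x = 0 ⇒ (j+1)(−m−j) eʲ x = f(e^{j+1} x) = 0`). [cite: Hall2015, §4.6 (Thm. 4.32, proof)] [cite: Beauville2010SL2, §5 (p. 6)] -/
theorem pow_apply_eq_zero_of_dual_apply_eq_zero (L : HasLefschetzProperty h e) (hgr : IsZGrading h) {m : ℤ} {x : M}
    (hx : x ∈ degreeSpace h m) (hf : L.dual hgr x = 0) {j₁ : ℕ} (hc : ∀ j : ℕ, j₁ ≤ j → ((j + 1) * (-m - j) : ℤ) ≠ 0) :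
    (e ^ j₁) x = 0 := by
  obtain ⟨n, hn⟩ := L.isNilpotent_of_hasLefschetzProperty hgr
  have hdesc : ∀ d : ℕ, (e ^ (j₁ + d)) x = 0 → (e ^ j₁) x = 0 := by
    intro d
    induction d with
    | zero => rw [add_zero]; exact id
    | succ d ih =>
      intro hd
      apply ih
      have h1 := L.dual_apply_pow_succ_of_dual_apply_eq_zero hgr hx hf (j₁ + d)
      rw [show j₁ + (d + 1) = j₁ + d + 1 by ring] at hd
      rw [hd, map_zero, eq_comm, smul_eq_zero] at h1
      exact h1.resolve_left (Int.cast_ne_zero.2 (hc (j₁ + d) (Nat.le_add_right j₁ d)))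
  exact hdesc n (by rw [pow_add, Module.End.mul_apply, hn, LinearMap.zero_apply, map_zero])

/-- **A lowest weight vector of weight `−k` is killed by `e^{k+1}`**: `x ∈ M_{−k}`, `f x = 0` ⇒ `e^{k+1} x = 0` (descent: the
coefficients `(j+1)(k−j)`, `j ≥ k+1`, are non-zero). [cite: Beauville2010SL2, §5 (p. 6)] [cite: Hall2015, §4.6 (Thm. 4.32, proof)] -/
theorem pow_succ_apply_eq_zero_of_dual_apply_eq_zero (L : HasLefschetzProperty h e) (hgr : IsZGrading h) {k : ℕ} {x : M}
    (hx : x ∈ degreeSpace h (-(k : ℤ))) (hf : L.dual hgr x = 0) : (e ^ (k + 1)) x = 0 :=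
  L.pow_apply_eq_zero_of_dual_apply_eq_zero hgr hx hf fun j hj ↦
    mul_ne_zero (by omega) (by omega)

/-- **`x ∈ P_{−k} ↔ f x = 0` for `x ∈ M_{−k}`** ("We say that `z` is primitive if [`Y z = 0`]"; the tree's `P_{−k}` is Cattani's
`M_{−k} ∩ ker e^{k+1}`). [cite: Beauville2010SL2, §5 (p. 6)] [cite: CattaniElZeinGriffithsLe2014, App. A Prop. A.3.9] -/
theorem mem_primitiveSpace_iff_dual_apply_eq_zero (L : HasLefschetzProperty h e) (hgr : IsZGrading h) {k : ℕ} {x : M}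
    (hx : x ∈ degreeSpace h (-(k : ℤ))) : x ∈ primitiveSpace h e k ↔ L.dual hgr x = 0 :=
  ⟨fun hp ↦ L.dual_apply_primitive hgr hp,
    fun hf ↦ mem_primitiveSpace_iff.2 ⟨hx, L.pow_succ_apply_eq_zero_of_dual_apply_eq_zero hgr hx hf⟩⟩

/-- **`P_{−k} = M_{−k} ∩ ker f`.** [cite: Beauville2010SL2, §5 (p. 6)] [cite: CattaniElZeinGriffithsLe2014, App. A Prop. A.3.9 ("P_ℓ = ker{N₋ : V_ℓ → V_{ℓ+2}}")] -/
theorem primitiveSpace_eq_degreeSpace_inf_ker_dual (L : HasLefschetzProperty h e) (hgr : IsZGrading h) (k : ℕ) :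
    primitiveSpace h e k = degreeSpace h (-(k : ℤ)) ⊓ LinearMap.ker (L.dual hgr) := by
  ext x
  rw [Submodule.mem_inf, LinearMap.mem_ker]
  exact ⟨fun hp ↦ ⟨(mem_primitiveSpace_iff.1 hp).1, L.dual_apply_primitive hgr hp⟩,
    fun hx ↦ (L.mem_primitiveSpace_iff_dual_apply_eq_zero hgr hx.1).2 hx.2⟩

/-- **Lowest weights are `≤ 0`** ("`g + s − 2p ≥ 0`"): a homogeneous vector of positive weight killed by `f` vanishes (descent to
`e⁰ x = x`: for `m > 0` every coefficient `(j+1)(−m−j)` is non-zero). [cite: Beauville2010SL2, §5 Proposition (p. 6)] [cite: Hall2015, §4.6 (Thm. 4.32)] -/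
theorem eq_zero_of_dual_apply_eq_zero_of_pos (L : HasLefschetzProperty h e) (hgr : IsZGrading h) {m : ℤ} (hm : 0 < m) {x : M}
    (hx : x ∈ degreeSpace h m) (hf : L.dual hgr x = 0) : x = 0 := by
  have h1 := L.pow_apply_eq_zero_of_dual_apply_eq_zero hgr hx hf (j₁ := 0) fun j _ ↦ mul_ne_zero (by omega) (by omega)
  rwa [pow_zero, Module.End.one_apply] at h1

/-- **`ker f = ⊕_k P_{−k}`**: the lowest weight vectors are exactly the sums of primitive vectors (`ker f` is `h`-stable —
`f (h x) = h (f x) + 2 f x` — hence graded; its pieces of positive weight vanish and its piece of weight `−k` is `P_{−k}`).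
[cite: Beauville2010SL2, §5 (p. 6: "The primitive elements are exactly the lowest weight elements")] -/
theorem ker_dual_eq_iSup_primitiveSpace (L : HasLefschetzProperty h e) (hgr : IsZGrading h) :
    LinearMap.ker (L.dual hgr) = ⨆ k : ℕ, primitiveSpace h e k := by
  refine le_antisymm ?_ (iSup_le fun k p hp ↦ LinearMap.mem_ker.2 (L.dual_apply_primitive hgr hp))
  intro x hx
  have hW : ∀ w ∈ LinearMap.ker (L.dual hgr), h w ∈ LinearMap.ker (L.dual hgr) := by
    intro w hw
    rw [LinearMap.mem_ker] at hw ⊢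
    have h1 := LinearMap.congr_fun (L.lie_h_dual hgr) w
    rw [Ring.lie_def, LinearMap.sub_apply, Module.End.mul_apply, Module.End.mul_apply, hw, map_zero, zero_sub,
      LinearMap.neg_apply, LinearMap.smul_apply, hw, smul_zero, neg_zero, neg_eq_zero] at h1
    exact h1
  have hgrW := isZGrading_restrict hgr hW
  have hxW : (⟨x, hx⟩ : LinearMap.ker (L.dual hgr)) ∈ ⨆ m : ℤ, degreeSpace (h.restrict hW) m := by
    rw [hgrW]; exact Submodule.mem_top
  refine Submodule.iSup_induction (fun m : ℤ ↦ degreeSpace (h.restrict hW) m)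
    (motive := fun w : LinearMap.ker (L.dual hgr) ↦ (w : M) ∈ ⨆ k : ℕ, primitiveSpace h e k) hxW ?_ ?_ ?_
  · intro m w hw
    rw [mem_degreeSpace_restrict_iff hW] at hw
    have hfw : L.dual hgr w = 0 := LinearMap.mem_ker.1 w.2
    rcases le_or_gt m 0 with hm | hm
    · obtain ⟨k, hk⟩ := Int.exists_eq_neg_ofNat hm
      rw [hk] at hw
      exact Submodule.mem_iSup_of_mem k ((L.mem_primitiveSpace_iff_dual_apply_eq_zero hgr hw).2 hfw)
    · rw [L.eq_zero_of_dual_apply_eq_zero_of_pos hgr hm hw hfw]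
      exact Submodule.zero_mem _
  · exact Submodule.zero_mem _
  · intro a b ha hb
    rw [Submodule.coe_add]
    exact Submodule.add_mem _ ha hb

/-! ### §2 At group level: the lower unipotents `ρ(1 0 ; a 1) = exp(a f)` fix exactly `ker f` -/

/-- **`f x = 0` ⇒ `ρ(1 0 ; a 1) x = x`**: `exp(a f) x = x + a f x + ⋯ = x`. [cite: Beauville2010SL2, §4 Theorem ("(1 0 ; a 1)·z = d⁻¹ a^g e^{θ/a} ∗ z") and §5 (p. 6)] -/
theorem sl2Rep_apply_eq_self_of_dual_apply_eq_zero (L : HasLefschetzProperty h e) (hgr : IsZGrading h) {x : M}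
    (hf : L.dual hgr x = 0) (γ : SL(2, K)) {a : K} (hγ : (γ : Matrix (Fin 2) (Fin 2) K) = !![1, 0; a, 1]) :
    L.sl2Rep hgr γ x = x := by
  letI := Algebra.compHom (Module.End K M) (algebraMap ℚ K)
  obtain ⟨n, hn⟩ := L.isNilpotent_smul_dual hgr a
  have hn1 : (a • L.dual hgr) ^ (n + 1) = 0 := by rw [pow_succ, hn, zero_mul]
  rw [L.sl2Rep_apply_of_coe_eq_lower hgr γ hγ, exp_eq_sum_range''' hn1, LinearMap.sum_apply, Finset.sum_eq_single 0]
  · rw [pow_zero, Nat.factorial_zero, Nat.cast_one, inv_one, one_smul, Module.End.one_apply]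
  · intro i _ hi
    obtain ⟨j, rfl⟩ := Nat.exists_eq_succ_of_ne_zero hi
    rw [LinearMap.smul_apply, pow_succ, Module.End.mul_apply, LinearMap.smul_apply, hf, smul_zero, map_zero, smul_zero]
  · intro h0
    exact absurd (Finset.mem_range.2 (Nat.succ_pos n)) h0

/-- **ONE lower unipotent fixing `x` forces `f x = 0`**: `ρ(1 0 ; a 1) x = x` with `a ≠ 0` ⇒ `f x = 0` (`exp` is injective on
nilpotents). [cite: Beauville2010SL2, §5 (p. 6: "lowest weight elements for the action of SL₂")] [cite: Hall2015, Ch. 2 Exercise 9] -/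
theorem dual_apply_eq_zero_of_sl2Rep_apply_eq_self (L : HasLefschetzProperty h e) (hgr : IsZGrading h) (γ : SL(2, K)) {a : K}
    (ha : a ≠ 0) (hγ : (γ : Matrix (Fin 2) (Fin 2) K) = !![1, 0; a, 1]) {x : M} (hx : L.sl2Rep hgr γ x = x) :
    L.dual hgr x = 0 := by
  letI := Algebra.compHom (Module.End K M) (algebraMap ℚ K)
  rw [L.sl2Rep_apply_of_coe_eq_lower hgr γ hγ] at hx
  have h1 := apply_eq_zero_of_exp_apply_eq_self (L.isNilpotent_smul_dual hgr a) hx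
  rw [LinearMap.smul_apply, smul_eq_zero] at h1
  exact h1.resolve_left ha

/-- **"The primitive elements are exactly the lowest weight elements for the action of `SL₂`"**: for `x ∈ M_{−k}`, `x ∈ P_{−k}` iff
`x` is fixed by the lower unipotent subgroup `{ρ(1 0 ; a 1)}` of `SL₂(K)`. [cite: Beauville2010SL2, §5 (p. 6)] -/
theorem mem_primitiveSpace_iff_forall_sl2Rep_apply_eq_self (L : HasLefschetzProperty h e) (hgr : IsZGrading h) {k : ℕ} {x : M}
    (hx : x ∈ degreeSpace h (-(k : ℤ))) :
    x ∈ primitiveSpace h e k ↔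
      ∀ (γ : SL(2, K)) (a : K), (γ : Matrix (Fin 2) (Fin 2) K) = !![1, 0; a, 1] → L.sl2Rep hgr γ x = x := by
  refine ⟨fun hp γ a hγ ↦ L.sl2Rep_apply_eq_self_of_dual_apply_eq_zero hgr (L.dual_apply_primitive hgr hp) γ hγ, fun H ↦ ?_⟩
  rw [L.mem_primitiveSpace_iff_dual_apply_eq_zero hgr hx]
  exact L.dual_apply_eq_zero_of_sl2Rep_apply_eq_self hgr (show SL(2, K) from ⟨!![(1 : K), 0; 1, 1], by
    rw [Matrix.det_fin_two_of]; ring⟩) one_ne_zero rfl (H _ 1 rfl)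

end HasLefschetzProperty

end Literature.Algebra.Lie
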